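import Literature.NumberTheory.Automorphic.GL2SphericalOfLFactorDegreeTwo
import Literature.NumberTheory.Automorphic.IwasawaDecompositionGL
import Literature.NumberTheory.Automorphic.MatrixCoefficientsSupercuspidalAdmissibleProofs
import HarnessLib

/-!
# A ramified twist of a spherical representation of `GL₂(F)` has trivial standard `L`-factor

Topic `Literature/NumberTheory/Automorphic`; proof file (theorems only: no definition, no named
fact, no instance).  Let `F` be a non-archimedean local field, `π` an irreducible smooth
representation of `GL₂(F)` on `V` with a non-zero `GL₂(𝒪_F)`-fixed vector, and `c : GL₂(F) → ℂˣ`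
a smooth character which is non-trivial on the compact diagonal subgroup `d(𝒪ˣ, 1)` — for
`c = χ ∘ det` this says that `χ : Fˣ → ℂˣ` is **ramified**.  **Theorem**
(`eq_one_of_hasRSLFactor_twist_of_spherical`, `eq_one_of_hasRSLFactor_twist_det_of_spherical`):
every JPSS `L`-polynomial `P` of the pair `(π ⊗ c, 𝟙_{GL₁})` — `L(s, (π ⊗ c) × 1) = 1/P(q^{-s})`,
`HasRSLFactor` of `RankinSelbergLocal`, at the invariant measure of
`natDegree_le_finrank_of_hasRSLFactor` — is `1`.  This is the local content of clause (10) of the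
twisted Hecke theory of `GL(2)` (`JacquetLanglands1970_twistedHeckeTheoryGL2`,
`Automorphic/TwistedHeckeTheoryGL2`): Jacquet–Langlands 1970, Prop. 3.5 (`L(s, χ ⊗ π(μ₁, μ₂)) =
L(s, μ₁χ) L(s, μ₂χ)`, which is `1` when the `μᵢ` are unramified and `χ` is ramified) read with
Lemma 3.9 (the spherical irreducible representations are the `π(μ₁, μ₂)` with `μᵢ` unramified);
Gelbart 1975, Thm. 6.15.

## Proof (classification-free, through the pole bound of `WhittakerTorusJacquetGL2`)

We do not use the classification of spherical representations.  Instead: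

* `coinvariants_mk_apply_of_mem_upperUnitriangular` — `[π(u) x] = [x]` in the Jacquet module
  `V_N = V / V(N)` for `u ∈ N` (Mathlib `Representation.Coinvariants.mk_self_apply`).
* `diagonalGL_mul_mul_inv_mem_upperUnitriangular` — the diagonal torus normalises `N`
  (deprecated alias of `diagonalGL_conj_mem_upperUnitriangular`).
* `coinvariants_mk_diagonal_eq_smul_of_span_eq_top` (**key lemma**, any `GL_n`): if `V` is
  spanned by the orbit of a vector `v₀` on which `K = GL_n(𝒪)` acts through a function `c`
  (`π(k) v₀ = c(k) v₀`), then every diagonal `k₀ ∈ K` acts on `V_N` by the scalar `c(k₀)`: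
  by the Iwasawa decomposition `g = u t k` (`exists_unipotent_mul_diagonal_mul_glInt`),
  `[π(g) v₀] = c(k) [π(t) v₀]`, and `k₀ u t k = (k₀ u k₀⁻¹) t k₀ k` with `k₀ u k₀⁻¹ ∈ N`, the
  diagonal torus being commutative.
* Hence for `π ⊗ c` with `π` spherical (`v₀` the spherical vector, `(π ⊗ c)(k) v₀ = c(k) v₀`) and
  `c(d(u, 1)) ≠ 1` for some unit `u`, the image in `V_N` of the `d(𝒪ˣ, 1)`-fixed vectors of
  `π ⊗ c` is `0` (`map_coinvariants_mk_fixedPoints_eq_bot_of_spherical_twist`): on such a vector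
  `[v] = [(π ⊗ c)(d(u,1)) v] = c(d(u,1)) [v]`.
* `finiteDimensional_coinvariants_of_smoothIrrep_fin_two` — `V_N` is finite-dimensional for every
  irreducible smooth representation of `GL₂(F)` (Steps A–B of `GL2SphericalOfLFactorDegreeTwo`:
  an irreducible quotient character of `V_N ≠ 0` and Frobenius reciprocity embed `π` into a
  principal series, whose Jacquet module has dimension `≤ 2`, and `r_N` is left exact).
* The pole bound `natDegree_le_finrank_of_hasRSLFactor` (Jacquet–Langlands 1970, §2; JPSS 1983,
  Thm. 2.7 (ii)) gives `deg P ≤ 0`, and `P(0) = 1` gives `P = 1`.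

## References

* H. Jacquet, R. P. Langlands, *Automorphic forms on GL(2)*, LNM 114 (1970), Prop. 3.5,
  Lemma 3.9, Thm. 2.18. [JacquetLanglands1970]
* S. Gelbart, *Automorphic forms on adele groups* (1975), Thm. 6.15. [Gelbart1975]
* H. Jacquet, I. I. Piatetski-Shapiro, J. Shalika, *Rankin–Selberg convolutions*, Amer. J. Math.
  105 (1983), Thm. 2.7 (ii). [JacquetPiatetskiShapiroShalika1983]
* D. Bump, *Automorphic forms and representations* (1997), Prop. 4.5.2 (Iwasawa decomposition),
  §4.6. [Bump1997]
-/

noncomputable section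

open scoped MatrixGroups
open MeasureTheory ValuativeRel Polynomial

namespace Literature.NumberTheory.Automorphic

/-! ### The unipotent radical, the diagonal torus and the Jacquet module of `GL_n` -/

section General

variable {F : Type*} [Field F] {n : ℕ} {V : Type*} [AddCommGroup V] [Module ℂ V]

/-- **`[π(u) x] = [x]` in the Jacquet module `V_N` for `u ∈ N`** (the upper unitriangular group is
the image of `unipotentRadicalP F id`; Mathlib `Representation.Coinvariants.mk_self_apply`).
The `upperUnitriangular` phrasing of the tree's `coinvariants_mk_apply_of_mem_unipotentRadicalGL`
(`ParabolicInductionSupercuspidalProofs.lean`, `c = id`), of which it is now a one-line instance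
(dedup-02562). [folklore] -/
theorem coinvariants_mk_apply_of_mem_upperUnitriangular (π : Representation ℂ (GL (Fin n) F) V)
    {u : GL (Fin n) F} (hu : u ∈ upperUnitriangular (Fin n) F) (x : V) :
    Representation.Coinvariants.mk (Representation.restrictUnipotentGL F (id : Fin n → Fin n) π) (π u x) =
      Representation.Coinvariants.mk (Representation.restrictUnipotentGL F (id : Fin n → Fin n) π) x :=
  coinvariants_mk_apply_of_mem_unipotentRadicalGL π hu x

/-- **The diagonal torus normalises `N`**: `diag(e) u diag(e)⁻¹` is upper unitriangular for `u`
upper unitriangular.  DUPLICATE (dedup-02563) of the tree's `diagonalGL_conj_mem_upperUnitriangular`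
(`WhittakerModelsProofs.lean`); kept only as a deprecated alias — the use below is rewired to the
survivor. [folklore] -/
@[deprecated (since := "2026-08-16")]
alias diagonalGL_mul_mul_inv_mem_upperUnitriangular := diagonalGL_conj_mem_upperUnitriangular

/-- Diagonal matrices commute. [folklore] -/
theorem diagonalGL_mul_comm (d e : Fin n → Fˣ) :
    diagonalGL (Fin n) F d * diagonalGL (Fin n) F e = diagonalGL (Fin n) F e * diagonalGL (Fin n) F d := by
  rw [← map_mul, ← map_mul, mul_comm]

variable [ValuativeRel F]

/-- **Key lemma: diagonal units act by scalars on the Jacquet module of a representation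
generated by a `K`-eigenvector.**  Let `π` be a representation of `GL_n(F)` on `V` and `v₀ ∈ V`
a vector on which `K = GL_n(𝒪)` acts through `c` (`π(k) v₀ = c(k) v₀`, `k ∈ K`) and whose orbit
spans `V`.  Then for every diagonal `k₀ = diag(e) ∈ K` (`|e_i| = 1`) and every `x ∈ V`,
`[π(k₀) x] = c(k₀) [x]` in `V_N`.  Proof: Iwasawa `g = u t k` (Bump 1997, Prop. 4.5.2), so
`[π(g) v₀] = c(k) [π(t) v₀]`, while `k₀ g = (k₀ u k₀⁻¹)(t k₀) k` with `k₀ u k₀⁻¹ ∈ N` and `t k₀ = k₀ t`,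
so `[π(k₀ g) v₀] = c(k) c(k₀) [π(t) v₀]`. [cite: Bump1997, Prop. 4.5.2] -/
theorem coinvariants_mk_diagonal_eq_smul_of_span_eq_top (π : Representation ℂ (GL (Fin n) F) V)
    {v₀ : V} (c : GL (Fin n) F → ℂ) (hv₀ : ∀ k ∈ glInt n F, π k v₀ = c k • v₀)
    (hspan : Submodule.span ℂ (Set.range fun g : GL (Fin n) F => π g v₀) = ⊤)
    {e : Fin n → Fˣ} (he : ∀ i, valuation F (e i : F) = 1) (x : V) :
    Representation.Coinvariants.mk (Representation.restrictUnipotentGL F (id : Fin n → Fin n) π)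
        (π (diagonalGL (Fin n) F e) x) =
      c (diagonalGL (Fin n) F e) •
        Representation.Coinvariants.mk (Representation.restrictUnipotentGL F (id : Fin n → Fin n) π) x := by
  set k₀ : GL (Fin n) F := diagonalGL (Fin n) F e with hk₀
  have hk₀K : k₀ ∈ glInt n F := diagonalGL_mem_glInt he
  set J := Representation.Coinvariants.mk (Representation.restrictUnipotentGL F (id : Fin n → Fin n) π)
    with hJ
  -- the two linear maps `x ↦ [π(k₀) x]` and `x ↦ c(k₀) [x]` agree on the spanning orbit
  suffices h : J ∘ₗ (π k₀) = c k₀ • J by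
    have := LinearMap.congr_fun h x
    simpa only [LinearMap.coe_comp, Function.comp_apply, LinearMap.smul_apply] using this
  refine LinearMap.ext_on_range hspan fun g => ?_
  rw [LinearMap.coe_comp, Function.comp_apply, LinearMap.smul_apply]
  -- Iwasawa decomposition of `g`
  obtain ⟨u, hu, d, k, hk, rfl⟩ := exists_unipotent_mul_diagonal_mul_glInt g
  -- `[π(u t k) v₀] = c(k) [π(t) v₀]`
  have h1 : J (π (u * diagonalGL (Fin n) F d * k) v₀) = c k • J (π (diagonalGL (Fin n) F d) v₀) := by
    rw [map_mul, map_mul, Module.End.mul_apply, Module.End.mul_apply, hv₀ k hk, map_smul, map_smul,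
      map_smul, coinvariants_mk_apply_of_mem_upperUnitriangular π hu]
  -- `k₀ (u t k) = (k₀ u k₀⁻¹) (t (k₀ k))`
  have h2 : k₀ * (u * diagonalGL (Fin n) F d * k) =
      (k₀ * u * k₀⁻¹) * (diagonalGL (Fin n) F d * (k₀ * k)) := by
    rw [hk₀, ← mul_assoc (diagonalGL (Fin n) F d), diagonalGL_mul_comm d e]
    group
  have h3 : J (π k₀ (π (u * diagonalGL (Fin n) F d * k) v₀)) =
      c k • c k₀ • J (π (diagonalGL (Fin n) F d) v₀) := by
    rw [← Module.End.mul_apply, ← map_mul, h2, map_mul, Module.End.mul_apply,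
      coinvariants_mk_apply_of_mem_upperUnitriangular π
        (diagonalGL_conj_mem_upperUnitriangular e hu),
      map_mul, Module.End.mul_apply, map_mul, Module.End.mul_apply, hv₀ k hk, map_smul, map_smul,
      hv₀ k₀ hk₀K, map_smul, map_smul, map_smul]
  rw [h3, h1, smul_comm]

end General

/-! ### `GL₂`: the image of the `d(𝒪ˣ, 1)`-fixed vectors of a ramified twist of a spherical
representation in the Jacquet module vanishes -/

section GLTwo

variable {F : Type*} [Field F] [ValuativeRel F] [TopologicalSpace F] [IsNonarchimedeanLocalField F]

omit [ValuativeRel F] [TopologicalSpace F] [IsNonarchimedeanLocalField F] in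
/-- `d(a, b) = diag(a, b)` as a value of `diagonalGL`. [folklore] -/
theorem diagGL2_eq_diagonalGL (a b : Fˣ) : (diagGL2 a b : GL (Fin 2) F) = diagonalGL (Fin 2) F ![a, b] := by
  refine Units.ext ?_
  rw [coe_diagGL2, coe_diagonalGL]
  ext i j
  fin_cases i <;> fin_cases j <;> simp

/-- **The Jacquet module of an irreducible smooth representation of `GL₂(F)` is
finite-dimensional** (Steps A–B of `GL2SphericalOfLFactorDegreeTwo`: if `V_N ≠ 0`, an irreducible
quotient of the finitely generated `T`-module `V_N` is a character `σ₀`, Frobenius reciprocity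
embeds `π` into `I(σ₀ ⊗ δ^{-1/2})`, whose Jacquet module has dimension `≤ 2`, and `r_N` is left
exact).  (Bernstein–Zelevinsky 1977, Thm. 5.2 context; Bump 1997, §4.5.)
[cite: BernsteinZelevinskyASENS1977, Thm. 5.2] -/
theorem finiteDimensional_coinvariants_of_smoothIrrep_fin_two (πv : SmoothIrrep (GL (Fin 2) F)) :
    FiniteDimensional ℂ (Representation.restrictUnipotentGL F (id : Fin 2 → Fin 2) πv.ρ).Coinvariants := by
  classical
  haveI := πv.isIrreducible
  have hπ : πv.ρ.IsSmooth := πv.isSmooth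
  rcases subsingleton_or_nontrivial
    (Representation.restrictUnipotentGL F (id : Fin 2 → Fin 2) πv.ρ).Coinvariants with hVN | hVN
  · haveI := hVN
    infer_instance
  haveI := hVN
  -- Step A: an irreducible quotient `σ₀` of the `T`-module `V_N` (a character) and `π ↪ I(σ)`
  obtain ⟨N₀, hN₀⟩ := Representation.exists_isCoatom_subrepresentation_jacquetGL F (id : Fin 2 → Fin 2) πv.ρ hπ
  haveI hσ₀irr : N₀.quotientRep.IsIrreducible := Subrepresentation.isIrreducible_quotientRep hN₀
  have hσ₀s : N₀.quotientRep.IsSmooth :=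
    (Representation.IsSmooth.jacquetGL F (id : Fin 2 → Fin 2) hπ).quotientRep N₀
  have hq0 : N₀.mkQ ≠ 0 := by
    intro h
    apply hN₀.1
    refine eq_top_iff.2 fun x _ => (N₀.mkQ_eq_zero_iff x).1 ?_
    rw [h]
    rfl
  obtain ⟨σ, hσ_def⟩ : ∃ σ : Representation ℂ (Π a, GL {i // (id : Fin 2 → Fin 2) i = a} F)
      ((Representation.restrictUnipotentGL F (id : Fin 2 → Fin 2) πv.ρ).Coinvariants ⧸ N₀.toSubmodule),
      σ = N₀.quotientRep.twist ((rootDeltaChar (standardParabolicGL F (id : Fin 2 → Fin 2))).comp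
        (leviEmbeddingP F (id : Fin 2 → Fin 2)))⁻¹ := ⟨_, rfl⟩
  have hσs : σ.IsSmooth := by
    rw [hσ_def]
    exact Representation.IsSmooth.twist_rootDeltaChar_inv F (id : Fin 2 → Fin 2) hσ₀s
  have hsc₀ := exists_apply_eq_smul_of_isIrreducible_levi_fin_two N₀.quotientRep hσ₀s
  obtain ⟨hWfd, hW1⟩ := finrank_eq_one_of_isIrreducible_of_smul N₀.quotientRep hsc₀
  haveI := hWfd
  -- Step B: `I(σ)_N` is finite-dimensional, `π ↪ I(σ)`, `r_N` is left exact
  obtain ⟨hJfd, -⟩ := finiteDimensional_coinvariants_parabolicIndGL_fin_two σ hσs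
  haveI := hJfd
  have hIs : (Representation.parabolicIndGL F (id : Fin 2 → Fin 2) σ).IsSmooth :=
    Representation.isSmooth_smoothInd _ _
  obtain ⟨f, hf⟩ : ∃ f : πv.ρ.IntertwiningMap (Representation.parabolicIndGL F (id : Fin 2 → Fin 2) σ),
      Function.Injective f := by
    rw [hσ_def]
    exact Representation.exists_injective_intertwiningMap_parabolicIndGL F (id : Fin 2 → Fin 2)
      πv.ρ hπ N₀.quotientRep N₀.mkQ hq0
  have hinj : Function.Injective (jacquetGLMap F (id : Fin 2 → Fin 2) f).toLinearMap :=
    jacquetGLMap_injective monotone_id hIs f hf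
  exact Module.Finite.of_injective (jacquetGLMap F (id : Fin 2 → Fin 2) f).toLinearMap hinj

omit [TopologicalSpace F] [IsNonarchimedeanLocalField F] in
/-- **For a ramified twist of a spherical representation, the `d(𝒪ˣ, 1)`-fixed vectors die in the
Jacquet module.**  Let `π` be irreducible on `V` with a non-zero `K`-fixed vector `v₀`, `c` a
character of `GL₂(F)` with `c(d(u, 1)) ≠ 1` for some unit `u`, and `H = d(𝒪ˣ, 1)`.  Then the
image in `V_N` of the `H`-fixed vectors of `π ⊗ c` is `0`: `V` is spanned by the orbit of `v₀`
(irreducibility), `(π ⊗ c)(k) v₀ = c(k) v₀` for `k ∈ K`, so `d(u, 1)` acts on `V_N` by `c(d(u,1))`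
(`coinvariants_mk_diagonal_eq_smul_of_span_eq_top`), while it fixes the class of an `H`-fixed
vector.  (Jacquet–Langlands 1970, Prop. 3.5 with Lemma 3.9, in Jacquet-module form.)
[cite: JacquetLanglands1970, Prop. 3.5 and Lemma 3.9] -/
theorem map_coinvariants_mk_fixedPoints_eq_bot_of_spherical_twist {V : Type*} [AddCommGroup V]
    [Module ℂ V] (π : Representation ℂ (GL (Fin 2) F) V) [π.IsIrreducible]
    (hsph : ∃ v : V, v ≠ 0 ∧ v ∈ π.fixedPoints (glInt 2 F)) (c : GL (Fin 2) F →* ℂˣ)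
    (hram : ∃ u : Fˣ, valuation F (u : F) = 1 ∧ c (diagGL2 u 1) ≠ 1)
    (H : Subgroup (GL (Fin 2) F))
    (hH : ∀ g : GL (Fin 2) F, g ∈ H ↔ ∃ u : Fˣ, valuation F (u : F) = 1 ∧ g = diagGL2 u 1) :
    Submodule.map (Representation.Coinvariants.mk
        (Representation.restrictUnipotentGL F (id : Fin 2 → Fin 2) (π.twist c)))
      ((π.twist c).fixedPoints H) = ⊥ := by
  obtain ⟨v₀, hv₀0, hv₀K⟩ := hsph
  obtain ⟨u, hu, hcu⟩ := hram
  haveI : (π.twist c).IsIrreducible := π.isIrreducible_twist c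
  -- `K` acts on `v₀` through `c` in `π ⊗ c`, and the orbit of `v₀` spans `V`
  have hv₀ : ∀ k ∈ glInt 2 F, (π.twist c) k v₀ = (((c k : ℂˣ) : ℂ)) • v₀ := fun k hk => by
    rw [Representation.twist_apply, (π.mem_fixedPoints (glInt 2 F) v₀).1 hv₀K k hk]
  have hspan : Submodule.span ℂ (Set.range fun g : GL (Fin 2) F => (π.twist c) g v₀) = ⊤ :=
    Representation.IsIrreducible.span_orbit_eq_top (π.twist c) hv₀0
  have he : ∀ i, valuation F ((![u, 1] : Fin 2 → Fˣ) i : F) = 1 := fun i => by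
    fin_cases i
    · exact hu
    · simp
  rw [eq_bot_iff]
  rintro _ ⟨v, hv, rfl⟩
  rw [Submodule.mem_bot]
  have hfix : (π.twist c) (diagGL2 u 1) v = v :=
    ((π.twist c).mem_fixedPoints H v).1 hv _ ((hH _).2 ⟨u, hu, rfl⟩)
  have key := coinvariants_mk_diagonal_eq_smul_of_span_eq_top (π.twist c) (fun g => ((c g : ℂˣ) : ℂ))
    hv₀ hspan he v
  rw [← diagGL2_eq_diagonalGL, hfix] at key
  -- `[v] = c(d(u,1)) [v]` with `c(d(u,1)) ≠ 1`
  have h1 : (1 - ((c (diagGL2 u 1) : ℂˣ) : ℂ)) •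
      Representation.Coinvariants.mk (Representation.restrictUnipotentGL F (id : Fin 2 → Fin 2) (π.twist c)) v = 0 := by
    rw [sub_smul, one_smul, ← key, sub_self]
  rcases smul_eq_zero.1 h1 with h | h
  · exfalso
    apply hcu
    exact Units.ext (sub_eq_zero.1 h).symm
  · exact h

/-! ### The `L`-factor of a ramified twist of a spherical representation is trivial -/

/-- **Jacquet–Langlands 1970, Prop. 3.5 with Lemma 3.9 (local form of clause (10) of the twisted
Hecke theory of `GL(2)`): the standard `L`-factor of a ramified twist of a spherical representation
is `1`.**  Let `π` be an irreducible smooth representation of `GL₂(F)` with a non-zero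
`GL₂(𝒪_F)`-fixed vector, `c : GL₂(F) → ℂˣ` a smooth character (open kernel) with `c(d(u, 1)) ≠ 1`
for some unit `u`, and `ψ` a non-trivial continuous additive character.  Then there is an invariant
Radon measure `ν` of full support on `GL₁(F) ⧸ U₁` (the one of
`natDegree_le_finrank_of_hasRSLFactor`) such that every `P` with
`HasRSLFactor (1<2) (π ⊗ c) 𝟙 ψ ν P` — `L(s, (π ⊗ c) × 1) = 1/P(q^{-s})`, JPSS 1983 Thm. 2.7 —
equals `1`: the pole bound gives `deg P ≤ dim (image of the d(𝒪ˣ,1)-fixed vectors in V_N) = 0`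
(`map_coinvariants_mk_fixedPoints_eq_bot_of_spherical_twist`), and `P(0) = 1`.
[cite: JacquetLanglands1970, Prop. 3.5 and Lemma 3.9] [cite: Gelbart1975, Thm. 6.15]
[cite: JacquetPiatetskiShapiroShalika1983, Thm. 2.7 (ii)] -/
theorem eq_one_of_hasRSLFactor_twist_of_spherical
    [MeasurableSpace (GL (Fin 1) F ⧸ upperUnitriangular (Fin 1) F)]
    [BorelSpace (GL (Fin 1) F ⧸ upperUnitriangular (Fin 1) F)]
    (πv : SmoothIrrep (GL (Fin 2) F)) (hsph : ∃ v : πv.V, v ≠ 0 ∧ v ∈ πv.ρ.fixedPoints (glInt 2 F))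
    (c : GL (Fin 2) F →* ℂˣ) (hc : IsOpen (c.ker : Set (GL (Fin 2) F)))
    (hram : ∃ u : Fˣ, valuation F (u : F) = 1 ∧ c (diagGL2 u 1) ≠ 1)
    {ψ : AddChar F Circle} (hψ : ψ.IsContinuousNontrivial) :
    ∃ ν : Measure (GL (Fin 1) F ⧸ upperUnitriangular (Fin 1) F),
      SMulInvariantMeasure (GL (Fin 1) F) (GL (Fin 1) F ⧸ upperUnitriangular (Fin 1) F) ν ∧
      IsFiniteMeasureOnCompacts ν ∧ ν.IsOpenPosMeasure ∧
      ∀ P : ℂ[X], HasRSLFactor Nat.one_lt_two (πv.ρ.twist c)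
        (Representation.trivial ℂ (GL (Fin 1) F) ℂ) ψ ν P → P = 1 := by
  classical
  letI : MeasurableSpace F := borel F
  haveI : BorelSpace F := ⟨rfl⟩
  -- the twist as an irreducible smooth representation
  set π' : SmoothIrrep (GL (Fin 2) F) := πv.twist c hc with hπ'_def
  haveI := π'.isIrreducible
  haveI := πv.isIrreducible
  have hπ' : π'.ρ.IsSmooth := π'.isSmooth
  haveI : FiniteDimensional ℂ
      (Representation.restrictUnipotentGL F (id : Fin 2 → Fin 2) π'.ρ).Coinvariants :=
    finiteDimensional_coinvariants_of_smoothIrrep_fin_two π'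
  obtain ⟨H, hH⟩ := exists_subgroup_diagGL2_units (F := F)
  obtain ⟨ν, hinv, hfin, hpos, hC⟩ := natDegree_le_finrank_of_hasRSLFactor π'.ρ hπ' hψ H hH
  refine ⟨ν, hinv, hfin, hpos, fun P hP => ?_⟩
  have hdeg := hC P hP
  have hbot : Submodule.map (Representation.Coinvariants.mk
      (Representation.restrictUnipotentGL F (id : Fin 2 → Fin 2) π'.ρ)) (π'.ρ.fixedPoints H) = ⊥ :=
    map_coinvariants_mk_fixedPoints_eq_bot_of_spherical_twist πv.ρ hsph c hram H hH
  rw [hbot, finrank_bot, Nat.le_zero] at hdeg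
  have h0 : P.eval 0 = 1 := hP.1
  rw [Polynomial.eq_C_of_natDegree_eq_zero hdeg, Polynomial.eval_C] at h0
  rw [Polynomial.eq_C_of_natDegree_eq_zero hdeg, h0, map_one]

/-- **The ramified-twist clause for `χ ∘ det`** (Jacquet–Langlands 1970, Prop. 3.5 with
Lemma 3.9: `L(s, χ ⊗ π) = 1` for `π` spherical and `χ` ramified).  For `π` irreducible smooth on
`GL₂(F)` with a non-zero `GL₂(𝒪_F)`-fixed vector and a continuous (open kernel) character
`χ : Fˣ → ℂˣ` which is ramified (`χ(u) ≠ 1` for some unit `u`), every JPSS `L`-polynomial of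
`(π ⊗ (χ ∘ det), 𝟙)` at the invariant measure of `natDegree_le_finrank_of_hasRSLFactor` is `1`.
[cite: JacquetLanglands1970, Prop. 3.5 and Lemma 3.9] [cite: Gelbart1975, Thm. 6.15] -/
theorem eq_one_of_hasRSLFactor_twist_det_of_spherical
    [MeasurableSpace (GL (Fin 1) F ⧸ upperUnitriangular (Fin 1) F)]
    [BorelSpace (GL (Fin 1) F ⧸ upperUnitriangular (Fin 1) F)]
    (πv : SmoothIrrep (GL (Fin 2) F)) (hsph : ∃ v : πv.V, v ≠ 0 ∧ v ∈ πv.ρ.fixedPoints (glInt 2 F))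
    (χ : Fˣ →* ℂˣ) (hχ : IsOpen (χ.ker : Set Fˣ))
    (hram : ∃ u : Fˣ, valuation F (u : F) = 1 ∧ χ u ≠ 1)
    {ψ : AddChar F Circle} (hψ : ψ.IsContinuousNontrivial) :
    ∃ ν : Measure (GL (Fin 1) F ⧸ upperUnitriangular (Fin 1) F),
      SMulInvariantMeasure (GL (Fin 1) F) (GL (Fin 1) F ⧸ upperUnitriangular (Fin 1) F) ν ∧
      IsFiniteMeasureOnCompacts ν ∧ ν.IsOpenPosMeasure ∧
      ∀ P : ℂ[X], HasRSLFactor Nat.one_lt_two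
        (πv.ρ.twist (χ.comp (Matrix.GeneralLinearGroup.det : GL (Fin 2) F →* Fˣ)))
        (Representation.trivial ℂ (GL (Fin 1) F) ℂ) ψ ν P → P = 1 := by
  refine eq_one_of_hasRSLFactor_twist_of_spherical πv hsph _ ?_ ?_ hψ
  · have hker : ((χ.comp (Matrix.GeneralLinearGroup.det : GL (Fin 2) F →* Fˣ)).ker : Set (GL (Fin 2) F)) =
        (Matrix.GeneralLinearGroup.det : GL (Fin 2) F →* Fˣ) ⁻¹' (χ.ker : Set Fˣ) := by
      ext g
      simp [MonoidHom.mem_ker]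
    rw [hker]
    exact hχ.preimage Matrix.GeneralLinearGroup.continuous_det
  · obtain ⟨u, hu, hχu⟩ := hram
    refine ⟨u, hu, ?_⟩
    have hdet : Matrix.GeneralLinearGroup.det (diagGL2 u 1 : GL (Fin 2) F) = u := by
      apply Units.ext
      rw [Matrix.GeneralLinearGroup.val_det_apply, coe_diagGL2, Matrix.det_fin_two_of]
      simp
    rwa [MonoidHom.coe_comp, Function.comp_apply, hdet]

end GLTwo

end Literature.NumberTheory.Automorphic
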